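import Summits.Parity.BatemanHorn.Theorems.SoloInformedLocatedHeuristic
import Summits.Parity.BatemanHorn.Theorems.SoloInformedRootLevelConstPos

/-!
# SoloInformedLocatedWindowMass — the CRT-expected located-root mass of a modulus window `(x^s, x^t]` is `(t−s)·A_g·x log x + O(x)`

Solo unit `solo-Parity-informed` (ideation tier, informed mode), session 141; `PLAN.md` §106, CLAIMS C242.

For `g ∈ ℤ[X]` and a window of moduli `(y₁, y₂]`, the CRT heuristic for the number of pairs `(n, e)` with
`1 ≤ n ≤ x`, `y₁ < e ≤ y₂`, `e ∣ g(n)` replaces the indicator "`n` is a root of `g` modulo `e`" by its mean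
`ρ_g(e)/e`:

  `W_g(x; y₁, y₂) = ∑_{1≤n≤x} ∑_{y₁<e≤y₂} ρ_g(e)/e = x·(L_g(y₂) − L_g(y₁))`   (`polyWindowHeuristic`,
  `polyWindowHeuristic_eq_mul_sub`), `L_g = polySmallLevel`.

From the Dedekind–Landau mean value `L_g(y) = A_g log y + O(1)` (`exists_abs_polySmallLevel_sub_log_le`,
`SoloInformedRootCountLevel`, `A_g = rootLevelConst g`) and `|log⌊y⌋ − log y| ≤ log 2`:

* `exists_abs_polySmallLevel_rpow_sub_le` — `|L_g(⌊x^s⌋) − s·A_g·log x| ≤ K_g` for all `x ≥ 1` and ALL `s ≥ 0`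
  (one constant, uniform in `s`);
* `exists_abs_polyWindowHeuristic_rpow_sub_le` — `|W_g(x; ⌊x^s⌋, ⌊x^t⌋) − (t−s)·A_g·x log x| ≤ 2K_g·x` for all
  `x ≥ 1`, `0 ≤ s ≤ t` (uniform in `s, t`);
* `exists_abs_polyWindowHeuristic_hb_sub_le` — the HEATH-BROWN WINDOW `(x^{1+δ}, x^{1+2δ}]` of
  [Heath-Brown, Proc. LMS (3) 82 (2001), Lemma 5: moduli `N(J) ∈ (X^{1+δ}, X^{1+2δ}]`, `δ ≤ 1/321`] carries CRT
  located-root mass `δ·A_g·x log x + O_{g,δ}(x)`;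
* `exists_abs_polyWindowHeuristic_first_sub_le` — the first window past `x`, `(x, x^{1+δ}]`, carries `δ·A_g·x log x + O(x)`;
* `tendsto_polyWindowHeuristic_hb_div_polyLocatedHeuristic` — for irreducible `g` of degree `d ≥ 3` the Heath-Brown
  window is the fraction `2δ/(d−2)` of the whole CRT located heuristic `H_g(x) ~ ((d−2)/2)·A_g·x log x`
  (`SoloInformedLocatedHeuristic`); for a cubic and `δ = 1/321` this is `2/321 < 0.7 %`.

Context (sharpest-statement annex §4.A, session 140): the only printed type-I information past `x` for cubic
`g` (Hooley 1978 conditionally, Heath-Brown 2001, Irving 2015) controls sieve-weighted root counts to moduli in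
exactly such a window, forced to factor, at incomplete-Kloosterman length `q^{1/3}`; this file records, in the
kernel, how small a share of the located-root mass `Mid_g(x)` (the open quantity in Erdős's `∑τ(g(n))` problem,
`SoloInformedRootCountLevel` / `SoloInformedLocatedHeuristic`) that window is expected to hold.  Elementary;
no sorry, no new axioms.
-/

namespace Summit.Parity.BatemanHorn.Theorems

open Finset Filter Polynomial
open scoped Topology
open Literature.NumberTheory.Sieve (polyRootCountMod)

/-! ### The window heuristic -/

/-- The CRT HEURISTIC for roots `n ≤ x` of `g` to moduli in the window `(y₁, y₂]`:
`W_g(x; y₁, y₂) = ∑_{1≤n≤x} ∑_{y₁<e≤y₂} ρ_g(e)/e`. [this work] -/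
noncomputable def polyWindowHeuristic (g : ℤ[X]) (x y₁ y₂ : ℕ) : ℝ :=
  ∑ _n ∈ Icc 1 x, ∑ e ∈ Ioc y₁ y₂, (polyRootCountMod ![g] e : ℝ) / e

/-- `W_g(x; y₁, y₂) = x·(L_g(y₂) − L_g(y₁))` for `y₁ ≤ y₂`. [this work] -/
theorem polyWindowHeuristic_eq_mul_sub (g : ℤ[X]) (x : ℕ) {y₁ y₂ : ℕ} (h : y₁ ≤ y₂) :
    polyWindowHeuristic g x y₁ y₂ = (x : ℝ) * (polySmallLevel g y₂ - polySmallLevel g y₁) := by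
  unfold polyWindowHeuristic
  rw [sum_const, Nat.card_Icc, add_tsub_cancel_right, nsmul_eq_mul, sum_Ioc_rootCount_div_eq_level_sub,
    max_eq_right h]

/-- The empty window: `W_g(x; y, y) = 0`. -/
theorem polyWindowHeuristic_self (g : ℤ[X]) (x y : ℕ) : polyWindowHeuristic g x y y = 0 := by
  rw [polyWindowHeuristic_eq_mul_sub g x le_rfl, sub_self, mul_zero]

/-- Windows add: `W_g(x; y₁, y₃) = W_g(x; y₁, y₂) + W_g(x; y₂, y₃)` for `y₁ ≤ y₂ ≤ y₃`. -/
theorem polyWindowHeuristic_add (g : ℤ[X]) (x : ℕ) {y₁ y₂ y₃ : ℕ} (h₁₂ : y₁ ≤ y₂) (h₂₃ : y₂ ≤ y₃) :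
    polyWindowHeuristic g x y₁ y₃ = polyWindowHeuristic g x y₁ y₂ + polyWindowHeuristic g x y₂ y₃ := by
  rw [polyWindowHeuristic_eq_mul_sub g x (h₁₂.trans h₂₃), polyWindowHeuristic_eq_mul_sub g x h₁₂,
    polyWindowHeuristic_eq_mul_sub g x h₂₃]
  ring

/-! ### `log ⌊y⌋ = log y + O(1)` and the level at real and power arguments -/

/-- `|log ⌊y⌋ − log y| ≤ log 2` for real `y ≥ 1`. [folklore] -/
theorem abs_log_natFloor_sub_log_le {y : ℝ} (hy : 1 ≤ y) :
    |Real.log (⌊y⌋₊ : ℝ) - Real.log y| ≤ Real.log 2 := by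
  have hf0 : 0 < ⌊y⌋₊ := Nat.floor_pos.mpr hy
  have hf1 : (1 : ℝ) ≤ (⌊y⌋₊ : ℝ) := by exact_mod_cast hf0
  have hfpos : (0 : ℝ) < (⌊y⌋₊ : ℝ) := by linarith
  have hypos : 0 < y := by linarith
  have hle : (⌊y⌋₊ : ℝ) ≤ y := Nat.floor_le hypos.le
  have hlt : y < (⌊y⌋₊ : ℝ) + 1 := Nat.lt_floor_add_one y
  have h1 : Real.log (⌊y⌋₊ : ℝ) ≤ Real.log y := Real.log_le_log hfpos hle
  have h2 : Real.log y ≤ Real.log 2 + Real.log (⌊y⌋₊ : ℝ) := by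
    rw [← Real.log_mul (by norm_num) hfpos.ne']
    exact Real.log_le_log hypos (by linarith)
  rw [abs_sub_comm, abs_of_nonneg (by linarith)]
  linarith

/-- The level at a real argument: `|L_g(⌊y⌋) − A_g log y| ≤ K` for all real `y ≥ 1`. [this work] -/
theorem exists_abs_polySmallLevel_natFloor_sub_le {g : ℤ[X]} (hirr : Irreducible g) (hdeg : 0 < g.natDegree) :
    ∃ K : ℝ, ∀ y : ℝ, 1 ≤ y → |polySmallLevel g ⌊y⌋₊ - rootLevelConst g * Real.log y| ≤ K := by
  obtain ⟨K, hK⟩ := exists_abs_polySmallLevel_sub_log_le hirr hdeg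
  refine ⟨K + |rootLevelConst g| * Real.log 2, fun y hy => ?_⟩
  have hf : 1 ≤ ⌊y⌋₊ := Nat.floor_pos.mpr hy
  have h1 := hK ⌊y⌋₊ hf
  have h2 := abs_log_natFloor_sub_log_le hy
  have hsplit : polySmallLevel g ⌊y⌋₊ - rootLevelConst g * Real.log y
      = (polySmallLevel g ⌊y⌋₊ - rootLevelConst g * Real.log (⌊y⌋₊ : ℝ))
        + rootLevelConst g * (Real.log (⌊y⌋₊ : ℝ) - Real.log y) := by ring
  rw [hsplit]
  refine (abs_add_le _ _).trans (add_le_add h1 ?_)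
  rw [abs_mul]
  exact mul_le_mul_of_nonneg_left h2 (abs_nonneg _)

/-- **The level at power arguments, uniformly in the exponent**: one constant `K_g` with
`|L_g(⌊x^s⌋) − s·A_g·log x| ≤ K_g` for all `x ≥ 1` and all real `s ≥ 0`. [this work] -/
theorem exists_abs_polySmallLevel_rpow_sub_le {g : ℤ[X]} (hirr : Irreducible g) (hdeg : 0 < g.natDegree) :
    ∃ K : ℝ, ∀ x : ℕ, 1 ≤ x → ∀ s : ℝ, 0 ≤ s →
      |polySmallLevel g ⌊(x : ℝ) ^ s⌋₊ - s * rootLevelConst g * Real.log x| ≤ K := by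
  obtain ⟨K, hK⟩ := exists_abs_polySmallLevel_natFloor_sub_le hirr hdeg
  refine ⟨K, fun x hx s hs => ?_⟩
  have hx1 : (1 : ℝ) ≤ (x : ℝ) := by exact_mod_cast hx
  have hx0 : (0 : ℝ) < (x : ℝ) := by linarith
  have hy : (1 : ℝ) ≤ (x : ℝ) ^ s := Real.one_le_rpow hx1 hs
  have h := hK _ hy
  rw [Real.log_rpow hx0] at h
  calc |polySmallLevel g ⌊(x : ℝ) ^ s⌋₊ - s * rootLevelConst g * Real.log x|
      = |polySmallLevel g ⌊(x : ℝ) ^ s⌋₊ - rootLevelConst g * (s * Real.log x)| := by ring_nf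
    _ ≤ K := h

/-! ### The window mass -/

/-- **CRT located-root mass of a power window, uniformly**: one constant `K_g` with
`|W_g(x; ⌊x^s⌋, ⌊x^t⌋) − (t−s)·A_g·x log x| ≤ K_g·x` for all `x ≥ 1` and all `0 ≤ s ≤ t`. [this work] -/
theorem exists_abs_polyWindowHeuristic_rpow_sub_le {g : ℤ[X]} (hirr : Irreducible g) (hdeg : 0 < g.natDegree) :
    ∃ K : ℝ, ∀ x : ℕ, 1 ≤ x → ∀ s t : ℝ, 0 ≤ s → s ≤ t →
      |polyWindowHeuristic g x ⌊(x : ℝ) ^ s⌋₊ ⌊(x : ℝ) ^ t⌋₊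
          - (t - s) * rootLevelConst g * ((x : ℝ) * Real.log x)| ≤ K * x := by
  obtain ⟨K, hK⟩ := exists_abs_polySmallLevel_rpow_sub_le hirr hdeg
  refine ⟨2 * K, fun x hx s t hs hst => ?_⟩
  have ht : 0 ≤ t := hs.trans hst
  have hx1 : (1 : ℝ) ≤ (x : ℝ) := by exact_mod_cast hx
  have hx0 : (0 : ℝ) ≤ (x : ℝ) := by linarith
  have hfl : ⌊(x : ℝ) ^ s⌋₊ ≤ ⌊(x : ℝ) ^ t⌋₊ :=
    Nat.floor_le_floor (Real.rpow_le_rpow_of_exponent_le hx1 hst)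
  rw [polyWindowHeuristic_eq_mul_sub g x hfl]
  have h1 := hK x hx s hs
  have h2 := hK x hx t ht
  have key : (x : ℝ) * (polySmallLevel g ⌊(x : ℝ) ^ t⌋₊ - polySmallLevel g ⌊(x : ℝ) ^ s⌋₊)
        - (t - s) * rootLevelConst g * ((x : ℝ) * Real.log x)
      = (x : ℝ) * ((polySmallLevel g ⌊(x : ℝ) ^ t⌋₊ - t * rootLevelConst g * Real.log x)
          - (polySmallLevel g ⌊(x : ℝ) ^ s⌋₊ - s * rootLevelConst g * Real.log x)) := by ring
  rw [key, abs_mul, abs_of_nonneg hx0]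
  calc (x : ℝ) * |(polySmallLevel g ⌊(x : ℝ) ^ t⌋₊ - t * rootLevelConst g * Real.log x)
          - (polySmallLevel g ⌊(x : ℝ) ^ s⌋₊ - s * rootLevelConst g * Real.log x)|
      ≤ (x : ℝ) * (K + K) :=
        mul_le_mul_of_nonneg_left ((abs_sub _ _).trans (add_le_add h2 h1)) hx0
    _ = 2 * K * x := by ring

/-- **The Heath-Brown window.**  For irreducible `g` of positive degree and `δ ≥ 0`, the CRT-expected number of
located roots `n ≤ x` to moduli `e ∈ (x^{1+δ}, x^{1+2δ}]` is `δ·A_g·x log x + O_{g}(x)` (the constant does not even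
depend on `δ`). [this work; window of Heath-Brown 2001, Lemma 5] -/
theorem exists_abs_polyWindowHeuristic_hb_sub_le {g : ℤ[X]} (hirr : Irreducible g) (hdeg : 0 < g.natDegree) :
    ∃ K : ℝ, ∀ x : ℕ, 1 ≤ x → ∀ δ : ℝ, 0 ≤ δ →
      |polyWindowHeuristic g x ⌊(x : ℝ) ^ (1 + δ)⌋₊ ⌊(x : ℝ) ^ (1 + 2 * δ)⌋₊
          - δ * rootLevelConst g * ((x : ℝ) * Real.log x)| ≤ K * x := by
  obtain ⟨K, hK⟩ := exists_abs_polyWindowHeuristic_rpow_sub_le hirr hdeg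
  refine ⟨K, fun x hx δ hδ => ?_⟩
  have h := hK x hx (1 + δ) (1 + 2 * δ) (by linarith) (by linarith)
  rwa [show (1 + 2 * δ) - (1 + δ) = δ by ring] at h

/-- **The first window past `x`.**  For irreducible `g` of positive degree and `δ ≥ 0`, the CRT-expected number of
located roots `n ≤ x` to moduli `e ∈ (x, x^{1+δ}]` is `δ·A_g·x log x + O_g(x)`. [this work] -/
theorem exists_abs_polyWindowHeuristic_first_sub_le {g : ℤ[X]} (hirr : Irreducible g) (hdeg : 0 < g.natDegree) :
    ∃ K : ℝ, ∀ x : ℕ, 1 ≤ x → ∀ δ : ℝ, 0 ≤ δ →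
      |polyWindowHeuristic g x x ⌊(x : ℝ) ^ (1 + δ)⌋₊
          - δ * rootLevelConst g * ((x : ℝ) * Real.log x)| ≤ K * x := by
  obtain ⟨K, hK⟩ := exists_abs_polyWindowHeuristic_rpow_sub_le hirr hdeg
  refine ⟨K, fun x hx δ hδ => ?_⟩
  have h := hK x hx 1 (1 + δ) zero_le_one (by linarith)
  rwa [Real.rpow_one, Nat.floor_natCast, show (1 + δ) - 1 = δ by ring] at h

/-- The Heath-Brown window normalised: `W_g(x; ⌊x^{1+δ}⌋, ⌊x^{1+2δ}⌋)/(x log x) → δ·A_g`. [this work] -/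
theorem tendsto_polyWindowHeuristic_hb_div {g : ℤ[X]} (hirr : Irreducible g) (hdeg : 0 < g.natDegree)
    {δ : ℝ} (hδ : 0 ≤ δ) :
    Tendsto (fun x : ℕ => polyWindowHeuristic g x ⌊(x : ℝ) ^ (1 + δ)⌋₊ ⌊(x : ℝ) ^ (1 + 2 * δ)⌋₊
        / ((x : ℝ) * Real.log x)) atTop (𝓝 (δ * rootLevelConst g)) := by
  obtain ⟨K, hK⟩ := exists_abs_polyWindowHeuristic_hb_sub_le hirr hdeg
  set c₀ : ℝ := δ * rootLevelConst g with hc₀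
  have h0 := tendsto_div_mul_log_of_abs_le (u := fun x : ℕ =>
    polyWindowHeuristic g x ⌊(x : ℝ) ^ (1 + δ)⌋₊ ⌊(x : ℝ) ^ (1 + 2 * δ)⌋₊ - c₀ * ((x : ℝ) * Real.log x))
    (C := K) (fun x hx => hK x (by omega) δ hδ)
  have h1 := h0.add_const c₀
  rw [zero_add] at h1
  refine h1.congr' ?_
  filter_upwards [eventually_ge_atTop 2] with x hx
  have hx' : (2 : ℝ) ≤ x := by exact_mod_cast hx
  have hne : (x : ℝ) * Real.log x ≠ 0 := by
    have : 0 < Real.log (x : ℝ) := Real.log_pos (by linarith)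
    positivity
  rw [sub_div, mul_div_assoc, div_self hne, mul_one]
  ring

/-- **The Heath-Brown window is the fraction `2δ/(d−2)` of the located heuristic.**  For irreducible `g` of degree
`d ≥ 3` and `δ ≥ 0`: `W_g(x; ⌊x^{1+δ}⌋, ⌊x^{1+2δ}⌋) / H_g(x) → 2δ/(d−2)`; for a cubic, `2δ` (with Heath-Brown's
`δ ≤ 1/321`: less than `0.7 %` of the CRT located-root mass). [this work] -/
theorem tendsto_polyWindowHeuristic_hb_div_polyLocatedHeuristic {g : ℤ[X]} (hirr : Irreducible g)
    (hdeg : 3 ≤ g.natDegree) {δ : ℝ} (hδ : 0 ≤ δ) :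
    Tendsto (fun x : ℕ => polyWindowHeuristic g x ⌊(x : ℝ) ^ (1 + δ)⌋₊ ⌊(x : ℝ) ^ (1 + 2 * δ)⌋₊
        / polyLocatedHeuristic g x) atTop (𝓝 (2 * δ / ((g.natDegree : ℝ) - 2))) := by
  have hA : 0 < rootLevelConst g := rootLevelConst_pos hirr (by omega)
  have hd : (3 : ℝ) ≤ (g.natDegree : ℝ) := by exact_mod_cast hdeg
  have hW := tendsto_polyWindowHeuristic_hb_div hirr (by omega) hδ
  have hH := tendsto_polyLocatedHeuristic_div hirr (by omega)
  have hne : ((g.natDegree : ℝ) - 2) / 2 * rootLevelConst g ≠ 0 := by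
    have : 0 < ((g.natDegree : ℝ) - 2) / 2 := by linarith
    positivity
  have hlim : δ * rootLevelConst g / (((g.natDegree : ℝ) - 2) / 2 * rootLevelConst g)
      = 2 * δ / ((g.natDegree : ℝ) - 2) := by
    field_simp
  rw [← hlim]
  refine (hW.div hH hne).congr' ?_
  filter_upwards [eventually_ge_atTop 2] with x hx
  have hx' : (2 : ℝ) ≤ x := by exact_mod_cast hx
  have hxl : (x : ℝ) * Real.log x ≠ 0 := by
    have : 0 < Real.log (x : ℝ) := Real.log_pos (by linarith)
    positivity
  rw [Pi.div_apply, div_div_div_cancel_right₀ hxl]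

/-- The cubic `X³ + 2`, `δ = 1/321` (Heath-Brown's exponent): the window `(x^{322/321}, x^{323/321}]` is expected to hold
the fraction `2/321` of the located roots. [this work] -/
theorem tendsto_polyWindowHeuristic_hb_div_polyLocatedHeuristic_cubic :
    Tendsto (fun x : ℕ => polyWindowHeuristic (X ^ 3 + C 2) x ⌊(x : ℝ) ^ (1 + (1 / 321 : ℝ))⌋₊
          ⌊(x : ℝ) ^ (1 + 2 * (1 / 321 : ℝ))⌋₊ / polyLocatedHeuristic (X ^ 3 + C 2) x)
      atTop (𝓝 (2 / 321)) := by
  have h := tendsto_polyWindowHeuristic_hb_div_polyLocatedHeuristic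
    Literature.NumberTheory.Sieve.LargestPrimeFactorCubic.irreducible_X_pow_three_add_two
    (by rw [natDegree_X_pow_add_C]) (δ := 1 / 321) (by norm_num)
  rw [natDegree_X_pow_add_C] at h
  convert h using 2
  norm_num

end Summit.Parity.BatemanHorn.Theorems
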